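import Literature.MathematicalPhysics.QuantumFieldTheory.Balaban1983to89.B14FlowStep
import Literature.MathematicalPhysics.QuantumFieldTheory.Balaban1983to89.B14Cor3

/-!
# `Balaban1983to89.B14Carve34Sect2ThmsHyp` — [Balaban1988Convergent] Sect. 2, pp. 254–264 [PDF 12–22]:
# «The Inductive Assumption and Formulations of Results» — (2.1)–(2.49), Theorem 1 (p. 262), Theorem 2 (p. 263,
# (2.43)–(2.44)), the consequences (2.45)–(2.49), Corollary 3 (Ultraviolet Stability) (2.50) (p. 264):
# THE HYPOTHESIS-FORM BUNDLE OF CARVING BLOCK 34, keyed to `B16.Construction` and `B14.Sect2Data`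

statement-level skeleton of published theorems with citation tags; proofs where landed; nothing here is a claim about the
Yang–Mills mass gap

SOURCE.  T. Bałaban, *Convergent renormalization expansions for lattice gauge theories*, Commun. Math. Phys. **119** (1988)
243–285, doi:10.1007/bf01217741 [`Balaban1988Convergent`] (cell paper "B14" = [III] of [Balaban1989LargeFieldI]∕[Balaban1989LargeFieldII];
its [I] = [Balaban1987RG1] = cell B12, [II] = [Balaban1988RG2Cluster] = B13; held `paper:balaban1988-cmp119-convergent-renormalization`,
journal page = PDF page + 242).  Pages 254–264 were read first-hand for this file on the page renders
`run/shared/lean/pub/pub-balaban/b2b-balaban-ref1/pages/1988-cmp119-convergent-renormalization/…-p012-x2.png` … `…-p022-x2.png`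
(the displays (2.6)–(2.7) p. 255, Theorem 1 p. 262, Theorem 2 with (2.43)–(2.46) p. 263, (2.47)–(2.50) p. 264) AND on the text layer
(`lit read … --pages 12-22`, which garbles the displays; line numbers «p0NNN.txt:Ln» below are text-layer lines).
STATUS of the source: published, refereed; the series' end statement is a CLAIM UNDER ADJUDICATION by the audit cell `pub-balaban`
(0∕13 main theorems of the series proved in the tree) — see `…B14`'s and `…B16`'s module docstrings.

WHY THIS FILE (cell `lit-balaban`, P6 CARVING FAN of D-0154 (3b); seat `lit-balaban-carve-02` g4, block 34 claimed under the cell lead's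
RULING #7 (5) ∕ RULING #8, `run/shared/lean/pub/lit-balaban/carve/STATUS.md` 2026-08-28T07:27:23Z ∕ 07:30:58Z; block row 34 of
`carve/BLOCKS-31-40.md` v1.1–v1.3 = `carve/CARVE-LIST.md` § Block 34; rules `carve/CARVE-RULES.md`; KEY item `stmt-QuantumFields-20542`
(K1⁷ `StabilityBAtRecordR13SepCoPH`, DAG n05–n13, whose conclusion carries `B16.EndStatementBPrinted (Node00.datumOfRecord₁₃SepCoPH …).C`
= [III] Theorem 1 ∧ [III] Corollary 3 at the construction of record), also-feeds `stmt-QuantumFields-20544`).  The block is Sect. 2 of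
[III]: the inductive assumption (2.1)–(2.42) — DEFINITIONS and ASSUMED PROPERTIES of the k-th density, not claims —, the two theorems
of the paper, the consequences (2.45)–(2.49) and Corollary 3.  At statement level this stretch is IN THE TREE (cell SKELETON: 47 rows —
19 proved-existing, 17 proved, 11 typed-existing; 3 591 in-tree declarations in 439 files cite a locator in the range, CARVE-LIST § Block
34; the §2 inductive description is typed GENERICALLY in `…Step` Part B3∕G (`Step.LFTower`, `Step.LFHyp`, `Step.LFHypB`, `Step.LFCov`, …)
and PINNED CONCRETELY for NODE 00's torus in `…Node00.Sect2FrameOfRecord` ∕ `…Node00.Sect2FormOfRecord`) — so, by the fan's rule «IN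
TREE = CITE, NEVER RESTATE» (CARVE-RULES §2.3), this file (a) RESTATES NOTHING: every printed statement of the block that has a
declaration is cited BY NAME below (table + census); (b) finds, after a sentence-by-sentence census of p. 254 l. 20 – p. 264 l. 21
against the tree, ONE printed statement of the block whose content the tree carries only as a quotation inside docstrings — the
parenthesis of Theorem 2, p. 263 «(In fact the constant R₁ can be taken as equal to 1 for g_j sufficiently small.)» — and types it in
hypothesis form (`R1EqOnePrinted`, §1); (c) conjoins the block's printed THEOREM-LEVEL statements, BY NAME and over the carriers the tree
states them on — [III]'s abstract §2 carrier `B14.Sect2Data` (a FAMILY `fam : I → B14.Sect2Data` of runs, as in `B14.Thm2Printed`) for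
Theorems 1–2, and the consumer's currency `C : B16.Construction` for the flow inequalities along the runs and for Corollary 3 — into ONE
hypothesis bundle `Hyp` a node prover takes as `(h : Hyp C H033 fam L β β′ β₀ κ₀)` (§2), with the kernel-checked bookkeeping a consumer
wants (§3): the projections, (2.6) ⇒ (2.7) along the runs by the tree's theorem, and the DICTIONARY by which [III] Theorem 1 over the
§2 data of the runs of `C` yields `B16.Thm1Printed C`, the printed proof shape `B16.InductionBase ∧ B16.InductionStep`, and — with the
bundle's Corollary 3 — the KEY item's conjunct `B16.EndStatementBPrinted C`.

## The block's SKELETON rows → the in-tree declarations this file CITES (never restates)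

(module prefix `…Balaban1983to89.` dropped; «H» = hypothesis-form `Prop`, «T» = theorem, «D» = definition∕structure with body)

| row | print | in tree | used here |
|---|---|---|---|
| B14.Def§2 | Sect. 2, the inductive description (2.1)–(2.42) pp. 254–262 as a whole | D `Step.LFConsts` ((2.4), (2.28), (2.31), (2.42) constants), D `Step.LFTower` (the three families 𝐄^{(j)}, 𝐑^{(j)}, 𝐁^{(j)} with their spaces), H `Step.LFHyp`, `Step.LFHypImproved`, `Step.LFHypB`, `Step.LFCov`, D `Step.LFActionData` ∕ `Step.LFActionData.action23` ((2.23)), H `Step.B14Thm1Shape`; concretely D `Node00.Sect2.towerOfTerms` ∕ `Node00.sect2TowerOfRecord` (`…Node00.Sect2FrameOfRecord`); the abstract statement carrier D `B14.Sect2Data`; the construction carrier D `B16.RunData` (`Sect2Form k` = «ρ_k has the form (2.18) and satisfies all the conditions and bounds described in Sect. 2 [III]»), D `B16.Construction` | carriers of `Hyp` |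
| B14.Eq2.1 ∕ B14.Eq2.2 | (2.1) + {S_j} pp. 254–255; (2.2) Γ_j, 𝐁 p. 255 | D `B14.Eq21Admissible.Adm21`, `Adm23`, `Admissible`, `R` (with T `S_nonempty`, `S_eq_layer_union_R`, `R_subset` — p. 255 «If Ω_j ∩ Λ_jᶜ is nonempty, then S_j is nonempty too; in fact it contains Ω_j ∖ Ω_j^{∼−1}», also T `B14Eq21Layer.layer_nonempty`, `nonempty_of_layer_subset`); D `B14.Eq218Concrete.Seq` ∕ `Chain21`; D `B14.Eq22Determines.blockIter` with T `eq_of_genSet_eq` (p. 255 «The set 𝐁 determines the sequence {Ω_j}»); D `Step.LFTower` (field `sys`) | cited |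
| B14.Eq2.3 | (2.3) Z_j = Λ_jᶜ + the 100MR_j-cube condition p. 255 | H `B14BoxFix.Cond23`, H `B14BoxFixWall.Cond23W` (T `B14BoxFix.*` the box-fixing it licenses) | cited |
| B14.Eq2.4 ∕ B14.Eq2.5-2.9 | (2.4) ε_j p. 255; (2.5) R_j p. 255 | D `p0Profile`, `epsK` (`…Setup`); D `B14.IsRj` (T `B14FlowStep.isRj_exists`) | cited |
| B14.Eq2.6 | (2.6) p. 255 with «where n > m, and β₀ > 0 can be chosen arbitrarily small, if g is sufficiently small. The inequalities follow from the renormalization group equations (0.20) [I], and from the properties of the β-functions» | H `B14.FlowIneq26`; T `B14.flow26_upper_of_rg`, `B14.flow26_lower_of_rg`, `B14.flowIneq26_of_rg_two_sided`, `B14FlowStep.flowControl_of_betaSign`, `flow26d_iff_partialSum`, `printed_hyps_fail_26d_27a` (WHICH properties of β give (2.6): an upper bound gives the first member, a SIGN the last — the sign is unprinted, cell GAPS G-r2.1); H `Dag.FlowStepPrinted` ∕ `DagBinding.leaves … |>.flowControl` (the located step T11.F) | field `Hyp.flow26` |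
| B14.Eq2.7 ∕ B14.Eq2.8 ∕ B14.Eq2.9 | (2.7) p. 255, (2.8)–(2.9) p. 256 «They imply the following inequalities … Similar inequalities hold for other constants, which will be introduced later» | H `B14.FlowIneq27`, `B14.FlowIneq28`, `B14FlowStep.FlowIneq29`; T `B14FlowStep.flowIneq27_of_26`, `flowIneq28_of_26`, `flowIneq28_of_26_monotone`, `flowIneq29_of_27`, `third_members`, `flowIneq28_alphaJ_of_26_monotone` (the «other constants» α_{0,j}, α_{1,j}), under the explicit smallness D `B14FlowStep.SmallnessFor` (T `smallnessFor_example`; that SOME smallness is needed: T `ineq27a_needs_smallness`, `ineq27b_needs_smallness`) — the sentence «They imply» is PROVED | `Hyp.flow27` (bookkeeping); cited |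
| B14.Def§2.p256 | p. 256 ll. 8–18: Ω_j, Λ_j unions of MR_j-cubes, «the distance between their boundaries is at least equal to 2MR_j», V_{j−1} «regular on Γ_{j−1} in the sense that ∣∂V_{j−1} − 1∣ < O(L²)ε_{j−1}» | D `B14.Def2p256.DomClass`, `BdDist`, `FieldRegular` (T `fieldRegular_zero`, `gammaRegion_pred_subset_compl`); T `B14DomainGeom.lambda320_far_from_compl` (the 2MR_j sentence at its (3.20) use), `B14SeparationOfRecord.*`; D `Node00.regSuppOfRecord` (`…Node00.LargeFieldBackgroundOfRecord`, the O(L²)ε_{j−1} support of record) | cited |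
| B14.Eq2.10 ∕ B14.Eq2.11 ∕ B14.Eq2.12 | (2.10) V = V_j on Γ_j; (2.11) M_𝐁; (2.12) the variational problem («For precise definitions and the theory of this variational problem see [15]») | T `B16Cor3Wilson.dependsOn_boltzmann`, `hpull_of_disjoint`, `pull_fails_without_disjointness` (§4 there: (2.10)–(2.16) as the source of the pull-out law); D `Averaging.iter` (`…Setup`); D `B11.VarProblem`, `B11.VarProblemX` ([15] = [Balaban1985Variational]) | cited |
| B14.Eq2.13 ∕ B14.Eq2.14-2.15 ∕ B14.Eq2.16 | (2.13) 𝐁_j(Ω), maximal domains, «It is easy to see that dist(Ω_j, Ωᶜ) ≧ 2M₁, or Ω^{∼−2} ⊃ Ω_j»; (2.14)–(2.15) the join 𝐁 ∪ 𝐁_j(Ω), U_{𝐁,Ω}, «We can also have a more complicated situation … summed up over the domains»; (2.16) U_{k,□}(V_k) | D `B14.Eq213MaximalDomains.maxDom`, `side` with T `dist_maxDom`, `maxDom_antitone`, `seq_subset_maxDom`; D `B14.Eq213DetSet.maxDomT` with T `maxDom_cover_deck`, `isUnionOfCubes_preimage_maxDomT` (§5 there: (2.14)–(2.15) on the torus);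 T `B15Eq133JoinDeterminingSet.*` (the «more complicated situation» at its [IV] use); D `B14.Eq216Concrete.feeds`, `liftIter`, T `qsstarGIter0_local` | cited |
| B14.Eq2.17 ∕ B14.Eq2.18 | (2.17) χ_k, (2.18) ρ_k = Σ χ_k 𝐓_k exp A_k p. 257 | D `Step.Repr218` (with T `B14Cor3.density_le_of_repr218`, `density_ge_of_repr218`, `partitionFn_le_of_repr218`); D `B14.Eq218Concrete.Seq`, `window`; H `B14.Claim264.Claim264Printed` with T `Claim264Printed_holds` (the (2.17)-consequence quoted on p. 264 after (3.1), PROVED); D `B16.RunData` fields `ρ`, `χ`, `Sect2Form` | cited |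
| B14.Eq2.19 ∕ B14.Eq2.20 ∕ B14.Eq2.22 | (2.19)–(2.20), (2.22) p. 258: factorization of 𝐓_k over components, «The operations corresponding to disjoint regions commute», the ordered product | D `Step.TkOps` ∕ H `Step.TkOps.Laws`; T `B14.Eq219Factorization.factor219`, `pairwise_commute`, `factor219_perm` (PROVED); T `TkOpsMarginal.LocalSystem.prod222` ((2.22) PROVED from Fubini–Tonelli) | cited |
| B14.Eq2.21 | (2.21) p. 258 + «More precisely, the quadratic form in the exponential couples only the fields A_j in the same component of Z_{j+1} ∩ Ω_{j+1}. The other terms of this quadratic form are included into the effective action into 𝐁-terms. If the operation 𝐓^{(j)} is changed by an 𝐑-operation, then the general form (2.21) is preserved, but the characteristic functions are changed, and the domain Z_{j+1} ∩ Ω_{j+1} ∩ X may be empty» | D `T4AdjointCovariance.OpCovariant` (T `opCovariant_iff_equivariant`, `comp`, `adjoint`); D `TkOpsMarginal.LocalSystem` (the shape of (2.21): fibre integration on the region); T `B14Components.*` («couples only … the same component») | cited |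
| B14.Eq2.23 ∕ B14.Eq2.25 ∕ B14.Eq2.30 | (2.23) p. 258, (2.25) p. 259, (2.30) p. 260 (the general form of A_k; 𝐄_k, 𝐑_k renormalized) | D `Step.LFActionData`, `Step.LFActionData.action23`; D `B14.Eq225Concrete.concrete`, `smearedWilson`, `E225`, `R230`, `B240` (T `smearedWilson_invSq_telescope`); H `B14Thm2.Eq223` (scalar form, T `B14Thm2.ineq249_of_223`) | cited |
| B14.Eq2.24 | (2.24) g_k⁻²(x) p. 259, «φ_j ∈ C₀^∞(Λ_j), φ_j = 1 on Λ_j^{∼−1}(?) . Thus g_j(x) = g_j on the last domain» | D `B14.LocalCoupling.invSq` (T `B14.LocalCoupling.*`, «on the last domain») | cited |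
| B14.Eq2.26-2.27 | (2.26)–(2.27) p. 259 with (i)–(iv), «Λ_j⁰ the set which is obtained by removing one layer of the MR_j-cubes from Λ_j^{(j)}» | D `Step.LFTower` (field `E`), H `Step.LFHyp` (fields `localDepE`, `boundE`, `gaugeInvE`), H `B14.Eq227LocalizedTerms.LFHypAnalytic` ((ii) analyticity; T `analyticOnNhd_E_chart`, `norm_E_chart_le`), D `B14.Eq227LocalizedTerms.Lambda0`, `admE`; D `Node00.Sect2.lambda0`, `Node00.Sect2.admE` | cited |
| B14.Eq2.28 | (2.28) α_{0,j}, α_{1,j} p. 259 «where q₀, q₁ are integers greater than 1, C₀, C₁ are sufficiently large positive numbers» | D `B14.alphaJ`, D `Step.LFConsts.alpha0` ∕ `alpha1`; T `B14FlowStep.flowIneq28_alphaJ_of_26_monotone`; the ratio ε_n ∕ α_{0,j} along the flow: T `B14Sum246Ratio.epsOverAlpha_le_ratio` | cited |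
| B14.Eq2.29 ∕ B14.Eq2.32-2.33 | (2.29) p. 260 Euclidean covariance of 𝐄^{(j)}(U_j, z) («We have it only for functions … defined by the equality (2.27) with the unrestricted summation … This implies that the function 𝐄^{(j)}(U_j, z) is invariant with respect to the Euclidean transformations of U_j leaving the point z invariant»); (2.32)–(2.33) covariance of 𝐑^{(j)} | D `Step.LFSymm` (`Ez`, `Rtot`), H `Step.LFCov`; H `B14.Eq358TranslInv.Eq358Transl` ((2.29) at its (3.58) use), T `B14.Eq358Covariance.eq358_of_229`, `kernel350_invariant_of_fix` («leaving the point z invariant») | cited |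
| B14.Eq2.31 | (2.31) p. 260 «∣𝐑^{(j)}(X,(𝐔,𝐉))∣ ≦ g_j^{κ₀} exp(−κd_j(X)). Here κ₀ can be chosen arbitrarily large, similarly as κ, if the other parameters are fixed properly, as in [I]» + «After the vacuum energy renormalization we obtain a sum of marginal terms … The sum over j is controlled by g_j^{κ₀}» | H `Step.LFHyp` (field `boundR`); T `B16.boundR231_of_ineq1100`, `B16.lfBoundR_new_of_ineq1100` ((2.31) for the NEW terms from [V] (1.100)); the marginal-terms sentence: `T4TermwiseResidual` §1 (its located (R-S) shape); the κ₀-remark as used: `B14Sum246Ratio` module docstring ∕ T `B14Sum246Ratio.bounds246_of_ratio4Weight` (cell GAPS G-adv3-31: the chain (2.31) ⇒ (2.44) ⇒ (2.46) reads κ₀ ≥ 11 for the printed κ₀ ≥ 7, harmless because «κ₀ can be chosen arbitrarily large») | cited |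
| B14.Def@261 | (2.34)–(2.39) p. 261, the space Ũ^c_j(X, α̃₀, α̃₁), «with an absolute constant B» (2.38), «The number β is a small positive constant, but not too small, e.g., we can take β = 1∕4. The spaces defined above are invariant with respect to G-valued gauge transformations» | D `B14RegularSpaces234.CondI234`, `CondII238`, `CondIII239`, `Satisfies234`, `space234`, `MSConsts`; D `B14Radii.rad234` (T `B14RegularSpaces234.rad234_mono`; the β ≤ 1∕4 arithmetic `B14Radii.*`); T `B14RegularSpaces234Gauge.satisfies234_act_iff`, `act_mem_space234_iff` (the G-invariance sentence PROVED); D `Node00.Sect2.spaceMS` | cited |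
| B14.Eq2.40-2.41 ∕ B14.Eq2.42 | (2.40)–(2.41) p. 261 with (i)–(iv), (2.42); p. 262 ll. 1–4 «The terms have a bit more precise localization property … If a component does not connect to Ω_j … then the functions does not depend on the fields (𝐔, 𝐉), A restricted to this component» | H `Step.LFHyp` (field `boundB`), H `Step.LFHypB` (fields `localDepB`, `gaugeInvB`, `compLocB` = the p. 262 component localization), D `Step.LFTower` (field `spaceB`), D `B14.Eq225Concrete.B240`, D `Node00.Sect2.admB` | cited |
| (p. 262 ll. 5–15) | «There are other possible forms of the inductive assumptions for the boundary terms … we obtain the bound (2.42) with d_j(X) replaced by d_j(X∖Z_j). All constructions and proofs of the procedure can be carried on with these inductive assumptions» | D `B16.RelDomainSys` (`dRel` = d_{j,Z}), T `B16.relBound_of_fullBound`, `B16.relDecay_not_fullDecay`; D∕T `B14.RelAnimal*` (`…B14RelAnimalBound`: the relative anchored tree-graph bound behind the resummed class, p. 262 ll. 6–15), `B14RelTreeLength`, `B14RelBoundary` (cell GAPS G-B16-05: relative vs full decay) | cited |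
| B14.Def§2.Ek | p. 262 «The constant E_k (depending on {Ω_j}, {Λ_j} also) is obtained by subtracting one-step vacuum energy expressions, generated in small field regions, from the initial constant E. This initial constant is defined in fact as a sum of all such expressions for all the lattices T^{(k)} as the small field regions» | D `B14.Def2Ek.Ek`, `Einit` with T `Ek_eq_sub_sum`, `Ek_Einit`, `Ek_Einit_self`, `neg_Ek_add` (WITH BODY) | cited |
| B14.Def§2.improved | p. 262 ll. 21–29 «after the operation T we obtain expressions with better analyticity and decay properties … defined on slightly larger spaces, with the coefficients in their definition bigger by β multiplied by a corresponding number, and … with the number κ replaced, for example, by (1 + 4β)κ. Such improved bounds are needed for the 𝐑-operation» | H `Step.LFHypImproved` (T `LFHypImproved.toWeak_E`); D `B14.Def2ImprovedSpace.enl`, H `B14.Def2ImprovedSpace.LFHypImprovedSpace` (the larger spaces; T `toImproved`, `toWeak_E∕R∕B`, `iff_improved_of_zero`) | cited |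
| B14.Thm1 | **Theorem 1** p. 262 (verbatim in `B14.Thm1Printed`'s docstring) with its two remarks («some of the restrictions on constants … come from the paper [I]»; «the operation 𝐑T transforms the space with the index k into the space with the index k + 1») | H `B14.Thm1Printed H033 S` ("(I.0.33)" — a reference with no matching display in [I] — as the PARAMETER `H033`; the cell's readings D `B14.H033Interval`, `B14.H033LogRunning`); the surge readings H `B14.ThmP245Printed` ∕ `ThmP245Spaces` ∕ `RAssumedP244` with T `B14.thm1Printed_of_thmP245`, `B14.mapsSpaces_of_thmP245Spaces` (the second remark), and their `…I` forms; over the tower H `Step.B14Thm1Shape`; in the consumer's currency H `B16.Thm1Printed` ([V] Thm 1 p. 355 = [III] Thm 1 p. 262, block 38's row) with its proof shape H `B16.InductionBase` ∕ `B16.InductionStep`, T `B16.thm1_of_steps`, `B16.inductionStep_of_thm1With`; at the record T `Node00.inductionBase_datumOfRecord₁₃SepCoPH`, `Node00.thm1Printed_datumOfRecord₁₃SepCoPH_of_tLaw_rOpLeaf` | field `Hyp.thm1`; `thm1B16_of_thm1B14`, `Hyp.thm1B16_of_dict`, `Hyp.base_step_of_dict` |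
| B14.Thm2 | **Theorem 2** p. 263, (2.43)–(2.44) (verbatim in `B14.Thm2Printed`'s docstring, incl. «The constant E₁ depends on β also, and grows to ∞ if β → 1» — expressed by β being bound BEFORE E₁ — and the R₁ = 1 parenthesis, quoted) | H `B14.Thm2Printed H033 fam L β κ₀` (FAMILY form: E₁, R₁ before the run index = «independent of j, k, Ω, {Ω_j}, {Λ_j}, T»), H `B14Thm2.Ineq243`, `B14Thm2.Ineq244`, T `B14Thm2.thm2Printed_iff`, `B14.thm2_single_of_family`; the point count «∣Γ_n ∩ Ω∣ means the number of points in the set Γ_n ∩ Ω ⊂ T₁^{(n)}»: T `B14.Eq243PointCount.card_blockSites`, `card_filter_le_rpow_mul`; p. 263 ll. 23–29 «It is an immediate consequence of the inequality with the set Λ_j⁰ ∩ Ω replaced by one point, and with the function φ replaced by a function … which is an element of a special decomposition of unity … The second inequality (2.44) is more elementary and easier to prove. It follows from the considerations of Sects. 3, 4 [I]»: H `B14Sect3.Rep367` ∕ `Rep244` with T `B14Sect3.ineq243_of_rep367`, `ineq244_of_rep244`, `thm2_conjuncts_of_reps` (the one-point route, PROVED as summation), D `B14.TentUnity.tentD`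 with T `tentD_decomposition_unity` (the special decomposition of unity), H `B14.Thm2Assembly.PointDataE` ∕ `PointDataR` with T `B14.Thm2Assembly.thm2Printed_of_pointData`, T `B14.Thm2DisplayChain.thm2Printed_of_domainBounds`, T `B14.Claim283RBound.perPointR_of_eq349` ((2.44) «from Sects. 3, 4 [I]») | field `Hyp.thm2`; `Hyp.ineq243_244` |
| (p. 263 l. 21–22) | «(In fact the constant R₁ can be taken as equal to 1 for g_j sufficiently small.)» — quoted in `B14Thm2.Ineq244`'s docstring; consumed as the smallness `R₁γ^{κ₀−6} ≤ 1` by T `B14Sum246Ratio.bounds246_of_ratio4Weight`, `B14FlowStep.bounds246_of_betaPos`; NO statement-level declaration before this file | **H `R1EqOnePrinted` (§1, NEW)** with T `ineq244_one_of_R1EqOne` |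
| B14.Eq2.45 ∕ B14.Eq2.46 ∕ B14.Eq2.45-2.49 | (2.45)–(2.46) p. 263 («Taking Ω = B^j(Λ_j⁰), φ = φ_j in (2.43), and summing … for κ₀ ≧ 7 and g sufficiently small») | H `B14.Bounds245to249` (binder `7 ≤ κ₀`); T `B14.geomStep_245`, `B14Thm2.bound245_of_243`, `bound246a_of_244`, `bound246_of_244`, `totals_of_ineq243_244`, `bounds245to249_of_perScale` (the summations PROVED); the coupling-sum step of (2.46): H `B14FlowStep.SumIneq246` with T `B14FlowStep.sumIneq246_of_betaPos`, `bounds246_of_betaPos`, `sumIneq246_needs_positive_b`, `Step.interval_hyp_not_sufficient_for_2_46` (NOT a consequence of the interval hypothesis alone: needs β_j ≥ b > 0 along the flow — cell GAPS G-f2.1), `B14Sum246Ratio.*` | field `Hyp.sum246`; cited |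
| B14.Eq2.47-2.48 | (2.47)–(2.48) p. 264 with p. 263 bottom («Bounds for the boundary terms (2.40) are even more elementary … for j > n it can be bounded by 2^{−(j−1−n)} … and this inequality with ∣Γ_n∖Λ_k⁰∣ for j = n. Summing over j from n to k, and then over n from 1 to k, we get (2.48)») | H `B14Thm2.Ineq247`; T `B14Thm2.bound248_of_247`, `inner_dyadic_le`; H `B14.Claim247.Claim247Printed` with T `B14.Claim247.Claim247Printed_holds`, `claim247_explicit` ((2.47) from (2.42) PROVED on its carrier), `B14Claim247Avg`, `B14Claim247Soft` | cited |
| B14.Eq2.49 | (2.49) p. 264 with «Finally, the vacuum energy counterterm E_k, except the terms logarithmic in coupling constants, has the same bound as above, only with a different constant» and «The first term on the right-hand side yields the small factors for large field characteristic functions. It also controls the logarithmic terms» | H `B14Thm2.Ineq249`, H `B14Thm2.VacuumRestBound` (the vacuum-counterterm sentence, hypothesis form), T `B14Thm2.ineq249_of_223`, `ineq249_of_perScale`, `exp_action_two_sided`; T `B14.LargeFieldFactorD4.largeFieldFactor_le_eps_pow_of_d_lt_four`, `exp_action_le_exp_neg_half_sq` («yields the small factors») | cited |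
| B14.Claim@264comb ∕ B14.Cor3 | p. 264 «Thus we estimate the integral ∫dV_kρ_k by a sum of terms similar to the one considered in Sect. 3 [6], e.g., see (3.42). The procedure is constructed in such a way, that the combinatorics now is the same, relative to the η-scale of the lattice T_η, as in [6], hence we have the same result for this scale» ([6] = [Balaban1982Higgs2], cell GAPS G-adv3-1 ∕ G-r2.5); **Corollary 3 (Ultraviolet Stability)** (2.50) p. 264 «Under the assumptions of Theorem 1 there exist constants E₋, E₊ independent of η and T, but depending on g_k, such that χ_k(T_η) exp[−g_k⁻² A(U_k(V_k)) − E₋∣T_η∣] ≦ ρ_k(V_k) ≦ e^{E₊∣T_η∣}» | D `B14Cor3.TermData` ∕ H `TermData.Holds` with T `B14Cor3.uvIneq_of_termData`, `le_of_sum_repr`, `ge_of_sum_repr`, `integral_le_of_termwise`; the five leaves H `B14Cor3.LeafH`, `LeafU1`, `LeafU2`, `LeafL1`, `LeafL2` over D `B14Cor3.ReprFamily` with T `B14Cor3.cor3With_of_leaves`, `cor3_250_of_leaves`, `cor3Leaf_of_leaves`; H `B16.UVIneq`, `B16.Cor3With`, **`B16.Cor3_250`** (the verbatim [III] Cor. 3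 with its dependence clause «independent of η and T, but depending on g_k» as dependence FUNCTIONS e±(g_k)), `B16.Cor3Leaf`, `B16.UVBound01` ∕ `UVBound01PerRun` ∕ `UVBound01PerBare` (the other printed dependence clauses, related exactly there), T `B16.uv01_of_cor3`, `B16.cor3_of_uvBound01`, `B16.endStatementBPrinted_of_leaves`; H `T4LimitDensity.E4Hyp` ((2.50) as consumed by the T⁴ docket) | field `Hyp.cor3`; `Hyp.cor3Leaf`, `Hyp.endStatementBPrinted_of_dict` |
| B14.§3 | forward references into Sect. 3 ((3.7), (3.8), (3.68)) | H `B14Sect3.Ineq37Printed`, `Ineq38Printed`, `Ineq368Printed` — block 35's rows | not this block |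

## Census of the REMAINING printed sentences of p. 254 l. 20 – p. 264 l. 21 (every sentence that asserts something)

* p. 254 ll. 20–31 (the programme of Sect. 2: «the operations corresponding to the operation T₁ in (1.29) are left undefined, only their
  basic general properties are formulated. Their inductive definition will follow successively from the constructions of the subsequent
  section and forth-coming papers») — narrative; it is WHY `B16.RunData.Sect2Form`, `Dag.Leaves.rOperation` and `B14.RAssumedP244` are
  abstract (p. 244 «The operation 𝐑 … we will only assume that it has some properties incorporated in the inductive description»): cited.
  (p. 254 ll. 1–19, incl. «Thus E₁ depends on Ω₁, Λ₁», is the end of Sect. 1 = block 33, `B14.Def2Ek.Ek_one`.)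
* p. 255 ll. 1–10 («we admit the possibility that Λ_j = Ω_j for some indices j. Such a situation may arise as a result of an 𝐑-operation»;
  the S_j sentence; «There is a characteristic function χ(Ω_j ∩ Λ_jᶜ, S_j) … R_j = S_j∖(Ω_j ∩ (Ω_jᶜ)^∼) … a function ζ(Ω_jᶜ) … their
  inductive definition will be given in the next section») — `B14.Eq21Admissible` (`Adm21` allows Λ_j = Ω_j; `R`, `R_eq`, `S_nonempty`),
  the characteristic functions are Sect. 3's (3.16)∕(3.21) objects `B14.Eq316.SmallFluct`, `B14.Eq316.chi321` (block 35): cited.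
* p. 255 ll. 14–17 («This definition is meant for sets of points, bonds and plaquettes, with the convention described in Sect. 0 [I]»; the
  determining set; «The domain Ω₁, or rather a small neighborhood of Ω₁ including a layer of M₁-cubes …, is called its support») —
  `B14.Eq22Determines` (`blockIter`, `IsBlockUnion`, `eq_of_genSet_eq`), `Node00.Sect2.regionOfSet` (the points∕bonds∕plaquettes
  convention of record): cited; «support» is a name.
* p. 255 ll. 20–22 (the rectangular-parallelepiped condition) — row B14.Eq2.3: cited.  p. 255 l. 23 – p. 256 l. 7 ((2.4)–(2.9) with
  their three sentences) — rows B14.Eq2.4–2.9: cited; (2.6) is the bundle's `flow26`, its consequences (2.7)–(2.9) are the tree's THEOREMS.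
* p. 256 ll. 8–12, 13–18 — row B14.Def§2.p256: cited.  p. 256 ll. 20–31 ((2.11), (2.12), «A regular configuration V on 𝐁 determines the
  minimal orbit … we will use all the results of [15]») — rows B14.Eq2.11–2.12; the existence∕uniqueness of the minimal orbit is [15] Thm 1
  = `B11.Thm1Printed` (cell B11), not this paper's claim: cited.
* p. 256 l. 32 – p. 257 l. 22 (the standard constructions: 𝐁_j(Ω), the maximal domains «Ω_n is a union of L^nξM₁-cubes, and
  dist(Ω_n, Ωᶜ_{n−1}) ≅ L^nξM₁», «It is easy to see that dist(Ω_j, Ωᶜ) ≧ 2M₁, or Ω^{∼−2} ⊃ Ω_j», (2.13); the localization to Ω with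
  «the distance between ∂Ω and this boundary … is greater than, or equal to 2M₁», (2.14)–(2.15); the several-domains variant; (2.16) with
  «Q_kV_k is defined as in (1.3), only 1-blocks are replaced by k-blocks») — rows B14.Eq2.13–2.16: cited (`B14.Eq213MaximalDomains.dist_maxDom`
  is the «easy to see» sentence PROVED; the several-domains join is typed at its [IV] (1.33) use, `B15Eq133JoinDeterminingSet`).
* p. 257 ll. 23–34 ((2.17) with «the cubes □ belong to the partition of the lattice T_η into cubes of the size LM₂R_k. This partition is
  compatible with all other partitions»; (2.18) with «the summation is over the admissible sequences of domains. Summation over the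
  sequences {S_j} is included in the operation 𝐓_k, and the effective action A_k depends on the sequences {Ω_j}, {Λ_j}, {S_j}») — rows
  B14.Eq2.17–2.18: cited (`Step.Repr218`, `B14.Eq218Concrete`, module `…Node00.TkOfRecord` — the {S_j}-summation inside 𝐓_k of record).
* p. 257 l. 35 – p. 258 l. 28 (the general description of 𝐓_k: «a composition of integrations restricted to large field regions in
  successive scales, and multiplications by characteristic functions, δ-functions defining renormalization transformations, and gauge
  fixing expressions»; «𝐓_k is supported in [Z_k]»; (2.19)–(2.22) with their sentences) — rows B14.Eq2.19–2.22: cited.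
* p. 258 ll. 29–36, p. 259 ll. 1–12 ((2.23) and the meaning of 𝐄_k («fully renormalized»), 𝐑_k («vacuum energy renormalization only»), 𝐁_k
  («does not require any renormalization»)) — row B14.Eq2.23: cited (the three renormalization clauses are the SHAPE of (2.25)∕(2.30)∕(2.40):
  `B14.Eq225Concrete.E225` subtracts the value at 1 AND the counterterm β_jA(φ_j, ·), `R230` subtracts the value at 1 only, `B240` nothing).
* p. 259 ll. 13–39 ((2.24)–(2.28) with (i)–(iv) «These properties are the same as in [I.I]») — rows B14.Eq2.24–2.28: cited.
* p. 260 ((2.29)–(2.33) with their sentences; the κ₀-remark; the marginal-terms paragraph «It explains why coupling constant renormalization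
  counterterms are not needed in (2.30) … The sum over j is controlled by g_j^{κ₀}»; «The above property will follow immediately from the
  construction of the 𝐑-terms given in the next paper»; p. 260 l. 38 – p. 261 l. 3 on 𝐁_k) — rows B14.Eq2.29–2.33: cited; (2.32) for the
  NEW terms is [V] p. 390's claim, H `Step.LFNewCov` (block 40's table).
* p. 261 ((2.34)–(2.42) with (i)–(iii), «with an absolute constant B», the β = 1∕4 sentence, the G-invariance sentence (PROVED:
  `B14RegularSpaces234Gauge.act_mem_space234_iff`), «This definition gives a more detailed and precise form … of the regularity conditions
  for background fields, introduced in [13–15]», (2.40)–(2.42) with (i)–(iv)) — rows B14.Def@261, B14.Eq2.40–2.42: cited.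
* p. 262 ll. 1–29 — rows B14.Eq2.40-2.41 (component localization), the alternative assumptions (table row «p. 262 ll. 5–15»),
  B14.Def§2.Ek, B14.Def§2.improved: cited.  p. 262 ll. 30–31 («The first theorem is a generalization of Theorem 3 [I]») — [I] Thm 3 =
  `B12.Thm3Printed` ∕ `Step.B12Thm3Shape`: cited.  p. 262 ll. 32–46 — row B14.Thm1 with both remarks: cited; field `Hyp.thm1`.
* p. 263 ll. 1–8 («Obviously we are interested not only in getting representations of the effective densities, but also in proving uniform
  bounds for them … We formulate bounds for the effective actions separately. We start with localized expressions and bounds. Let Ω be a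
  domain from 𝐃_k contained in B^j(Λ_j⁰), and let φ ∈ C₀^∞(Ω^∼), φ = 1 on Ω. Notice that here Ω^∼ denotes the union of the domains
  (Ω ∩ (Ω_n∖Ω_{n+1}))^∼, n = j, …, k, the operation ∼ is in the corresponding scale») — the SETTING of Theorem 2 (a definition of the test
  class (Ω, φ), not a claim): in the tree ABSTRACTLY as the index type `B14.Sect2Data.Ω` («ω ranging over the admissible data (Ω, φ, U_k)»,
  `B14Thm2.Ineq243`'s docstring) and, for the point count, `B14.Eq243PointCount.blockSites`; the concrete class is NOT typed in the tree —
  a DEFINITION task noted for the [B14] fold owner (row candidate «B14.Def@263 test pairs (Ω, φ) of Thm 2»), outside a hypothesis-form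
  carve (CARVE-RULES §2.4 types statements).
* p. 263 ll. 9–22 — row B14.Thm2: cited; field `Hyp.thm2`; the parenthesis ll. 21–22 is §1's `R1EqOnePrinted`.
* p. 263 ll. 23–29 — the one-point route and «(2.44) … follows from the considerations of Sects. 3, 4 [I]»: cited (table row B14.Thm2).
* p. 263 l. 29 – p. 264 l. 12 ((2.45)–(2.49) with every sentence) — rows B14.Eq2.45–2.49: cited; the coupling-sum clause of (2.46) is
  field `Hyp.sum246`.
* p. 264 ll. 13–18 — row B14.Claim@264comb: cited.  p. 264 ll. 19–21 — row B14.Cor3: cited; field `Hyp.cor3`.  p. 264 l. 22 onwards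
  (Sect. 3, (3.1) …) is block 35 (`B14Carve35Sect3ProofHyp`, carve-09 g3; `B14.Claim264.Claim264Printed` is the first sentence after (3.1)).

RESULT OF THE CENSUS: ONE printed statement of pp. 254–264 lacked a statement-level declaration — the R₁ = 1 parenthesis of Theorem 2
(§1 below); every other sentence has an in-tree home, cited above.  The printed passages the cell has LOCATED as needing unprinted input
travel with the cited names, never restated here: (2.6)'s last member needs a SIGN of the β-functions (`B14.flow26_lower_of_rg`,
`B14FlowStep.printed_hyps_fail_26d_27a`; cell GAPS G-r2.1); (2.46)'s middle member needs β_j ≥ b > 0 along the flow, not the interval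
hypothesis alone (`B14FlowStep.sumIneq246_needs_positive_b`, `Step.interval_hyp_not_sufficient_for_2_46`; GAPS G-f2.1); (2.8)'s first
member carries (1+β₀)² from (2.6)+(2.7) as printed (`B14FlowStep.eps28a_sq_of_26`; DIVERGENCE D-sb14.1); "(I.0.33)" of Theorem 1 does not
resolve (GAPS G2; `B14.H033Interval` ∕ `H033LogRunning`); Corollary 3's dependence clause vs (0.1) [V]'s (GAPS G-pv24-1; `B16.UVBound01*`).

## What is here
* §1 `R1EqOnePrinted fam H033 κ₀` — the parenthesis of Theorem 2, p. 263 ll. 21–22, in hypothesis form over the family carrier of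
  `B14.Thm2Printed`: ONE threshold γ₁ > 0 («for g_j sufficiently small») such that on every run of the family, under Theorem 1's
  hypotheses, (2.44) holds with R₁ = 1 at every (j, k, Ω) whose coupling g_j lies below γ₁; `ineq244_one_of_R1EqOne` — on a run all of
  whose couplings lie below γ₁ this IS `B14Thm2.Ineq244 (fam i) 1 κ₀` (bookkeeping).
* §2 `Hyp C H033 fam L β β′ β₀ κ₀` — ONE `Prop`-valued structure conjoining BY NAME the block's theorem-level printed statements:
  `flow26` = (2.6) p. 255 along every run of `C` whose couplings lie in a window ]0, γ] («if g is sufficiently small»; `B14.FlowIneq26`, the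
  tree's `Dag.Leaves.flowControl` as bound by `DagBinding.leaves`); `sum246` = the coupling-sum clause of (2.46) p. 263 «for κ₀ ≧ 7 and g
  sufficiently small» (`B14FlowStep.SumIneq246`); `thm1` = Theorem 1 p. 262 for every run of the family (`B14.Thm1Printed H033 (fam i)`);
  `thm2` = Theorem 2 p. 263 (`B14.Thm2Printed H033 fam L β κ₀`); `cor3` = Corollary 3 p. 264 (`B16.Cor3_250 C`).  Explicit carriers: the
  construction `C : B16.Construction` (runs `P : B12.RunParams`, couplings `(C P).flow`), the dangling hypothesis "(I.0.33)" as the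
  parameter `H033 : Flow → ℕ → Prop` exactly as in `B14.Thm1Printed`, the family `fam : I → B14.Sect2Data` of §2 data, the constants
  `L, β, κ₀` of Theorem 2 and `β′, β₀` of (2.6).  Hypothesis slot only; nothing asserted.
* §3 kernel-checked bookkeeping out of `Hyp` (no statement asserted): `Hyp.inductiveAssumption` (Theorem 1's conclusion at one run and
  step), `Hyp.ineq243_244` ((2.43) ∧ (2.44) with the uniform constants, `B14Thm2.thm2Printed_iff`), `Hyp.cor3Leaf` (`B16.Cor3Leaf C`),
  ★ `Hyp.flow27` — p. 255 «They imply the following inequalities» for (2.7) ALONG THE RUNS: from `flow26` and the tree's theorem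
  `B14FlowStep.flowIneq27_of_26`, under its explicit smallness `B14FlowStep.SmallnessFor γₛ β′ β₀ L_b p`, one window `min γ γₛ` serving all
  runs; ★ the DICTIONARY between the two in-tree typings of Theorem 1 — `sect2FormAll_of_thm1B14` ∕ `thm1B16_of_thm1B14`: if the §2 datum
  `fam (ι P)` of each run `P` of `C` has `K = P.K`, the run's flow, and an inductive-assumption predicate implying `(C P).Sect2Form`, if
  the couplings of the windowed runs satisfy (0.20) [I] (`Flow.SatisfiesRG`, Theorem 1's «determined by the recursive renormalization group
  equations»), and "(I.0.33)" is read as the interval hypothesis `B14.H033Interval γ` (the reading [V] p. 355 prints), then [III] Theorem 1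
  over the family gives `B16.Thm1Printed C`; hence `Hyp.thm1B16_of_dict`, `Hyp.base_step_of_dict` (`B16.InductionBase C γ ∧
  B16.InductionStep C γ` — the base block 40's bundle `B16Carve40BoundsCor3Hyp.Hyp.thm1_of_base` asks for — by `B16.inductionStep_of_thm1With`)
  and ★ `Hyp.endStatementBPrinted_of_dict` (`B16.EndStatementBPrinted C` = the KEY item's B16 conjunct, by `B16.endStatementBPrinted_of_leaves`
  ∕ the pair ⟨Theorem 1, Corollary 3⟩).

## HONEST SCOPE — what is NOT claimed
Nothing of [III] is proved here and no `…Printed` statement is asserted: `R1EqOnePrinted` and `Hyp` are HYPOTHESES; the theorems are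
bookkeeping between typed shapes (projections, a `min` of two windows, one rewrite along a run dictionary).  `Hyp` conjoins the two
theorems and the corollary the paper STATES in Sect. 2 — their printed proofs are Sect. 3 (block 35; Theorem 2 and the T-half of the
step), [IV] and [V] (blocks 36–40; the 𝐑-operation) — so that, modulo the run dictionary, `Hyp` CONTAINS the KEY item's B16 conjunct
(`Hyp.endStatementBPrinted_of_dict`): taking `(h : Hyp …)` is taking [III]'s end results as hypotheses, which is this fan's contract
(CARVE-RULES §2.4–2.5), not a discharge; the node provers of N11∕N13 discharge them (at the record: `Node00.inductionBase_datumOfRecord₁₃SepCoPH`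
is a THEOREM, the step is `…of_tLaw_rOpLeaf`).  With carriers chosen freely the bundle is SATISFIABLE BY DEGENERATE DATA in part (an empty
family index `I` makes `thm1`∕`thm2` vacuous; a construction with no run in any window makes `flow26`∕`sum246` vacuous) — it earns its keep
only at Bałaban's objects (the cell's NODE 00 record), not typed here.  (2.6) and the (2.46) clause are carried AS PRINTED («if g is
sufficiently small») although the cell has located that the interval hypothesis alone does not give them (above); Corollary 3 is carried in
[III]'s dependence reading `B16.Cor3_250` (E± functions of g_k), not in (0.1) [V]'s run-uniform reading `B16.UVBound01`.  No summit
statement is proved by this seat; K1⁷ ∕ nodes n05–n13 are NOT discharged; the file moves no node count; one lattice paper at finite K —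
nothing continuum ∕ ℝ⁴ ∕ OS ∕ mass-gap ∕ Clay.  No `sorry`, no `instance`, no `notation`, no attribute manipulation; imports
`…B14FlowStep` (hence `…B14`, `…B14Thm2`, `…Step`, `…Setup`) and `…B14Cor3` (hence `…B16`) only.
-/

namespace Literature.MathematicalPhysics.QuantumFieldTheory.Balaban1983to89.B14Carve34Sect2ThmsHyp

open Literature.MathematicalPhysics.QuantumFieldTheory.Balaban1983to89

/-! ## §1 The residual printed statement of the block, in hypothesis form -/

/-- **Theorem 2, the parenthesis after (2.44)** (p. 263 ll. 21–22 [PDF 21, `p0021.txt:L21–L22`]), verbatim: *«for the regular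
configurations U_k. (In fact the constant R₁ can be taken as equal to 1 for g_j sufficiently small.)»* — where (2.44) is *«∣Σ_{X∈𝐃_j,
X⊂Λ_j, X∩Ω≠∅} [𝐑^{(j)}(X, U_k) − 𝐑^{(j)}(X, 1)]∣ ≦ R₁ g_j^{κ₀} Σ_{n=j}^{k} ∣Γ_n ∩ Ω∣»* (in tree: `B14Thm2.Ineq244`, the second conjunct
of `B14.Thm2Printed`, whose docstrings QUOTE this parenthesis without typing it).  Hypothesis form over the FAMILY carrier of
`B14.Thm2Printed` (runs `fam i : B14.Sect2Data`, `(fam i).rTerm j k ω` = the left-hand side of (2.44), `(fam i).gammaVol n ω` = ∣Γ_n ∩ Ω∣,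
`ω` ranging over the admissible data (Ω, φ, U_k)): «for g_j sufficiently small» = ONE threshold `γ₁ > 0`, chosen before the run index
like R₁ itself («absolute constant»), below which the coupling `g_j` OF THE SCALE `j` of the estimate must lie; «under the assumptions of
Theorem 1» = the two hypotheses of `B14.Thm1Printed` ((0.20) [I] `Flow.SatisfiesRG` and the parameter `H033` for "(I.0.33)").  Hypothesis
slot only; nothing asserted (the cell's reading of the chain (2.31) ⇒ (2.44), GAPS G-adv3-31, travels with `B14Sum246Ratio`).
[cite: Balaban1988Convergent, Thm 2 (2.44) p.263 ll.21-22] -/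
def R1EqOnePrinted {I : Type} (fam : I → B14.Sect2Data) (H033 : Flow → ℕ → Prop) (κ₀ : ℕ) : Prop :=
  ∃ γ₁ : ℝ, 0 < γ₁ ∧ ∀ i : I, (fam i).flow.SatisfiesRG (fam i).K → H033 (fam i).flow (fam i).K →
    ∀ j k ω, 1 ≤ j → j ≤ k → k ≤ (fam i).K → (fam i).flow.g j ≤ γ₁ →
      |(fam i).rTerm j k ω| ≤ ((fam i).flow.g j) ^ κ₀ * ∑ n ∈ Finset.Icc j k, (fam i).gammaVol n ω

/-- Bookkeeping: under the parenthesis, on every run of the family all of whose couplings `g_1, …, g_K` lie below the threshold, (2.44)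
holds WITH R₁ = 1 in the tree's typed form `B14Thm2.Ineq244 (fam i) 1 κ₀` (`one_mul`). [cite: Balaban1988Convergent, Thm 2 (2.44) p.263 ll.21-22 (bookkeeping)] -/
theorem ineq244_one_of_R1EqOne {I : Type} {fam : I → B14.Sect2Data} {H033 : Flow → ℕ → Prop} {κ₀ : ℕ}
    (h : R1EqOnePrinted fam H033 κ₀) :
    ∃ γ₁ : ℝ, 0 < γ₁ ∧ ∀ i : I, (fam i).flow.SatisfiesRG (fam i).K → H033 (fam i).flow (fam i).K →
      (∀ j, 1 ≤ j → j ≤ (fam i).K → (fam i).flow.g j ≤ γ₁) → B14Thm2.Ineq244 (fam i) 1 κ₀ := by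
  obtain ⟨γ₁, hγ₁, hall⟩ := h
  refine ⟨γ₁, hγ₁, fun i hrg h033 hsmall j k ω hj hjk hk => ?_⟩
  have hle := hall i hrg h033 j k ω hj hjk hk (hsmall j hj (le_trans hjk hk))
  simpa only [one_mul] using hle

/-! ## §2 The block-34 hypothesis bundle -/

/-- **BLOCK 34 OF [III] AS ONE HYPOTHESIS BUNDLE** (Sect. 2, pp. 254–264 [PDF 12–22]): the printed THEOREM-LEVEL statements of the block
that the tree carries in hypothesis form, conjoined BY NAME over their in-tree carriers —
`flow26` = **(2.6) p. 255** along every run of the construction whose couplings lie in a window ]0, γ] (*«The coupling constants g_j satisfy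
the inequalities g_n ≦ (1 + g_n²β′(n−m))^{1∕2} g_m ≦ … ≦ (1+β₀)(n−m)^{1∕2} g_m, g_m ≦ (1+β₀) g_n, (2.6) where n > m, and β₀ > 0 can be
chosen arbitrarily small, if g is sufficiently small.»*; `B14.FlowIneq26`, first and last members — the tree's `Dag.Leaves.flowControl` as
bound by `DagBinding.leaves`; its consequences (2.7)–(2.9) are THEOREMS of `…B14FlowStep`, see `Hyp.flow27`);
`sum246` = **the coupling-sum clause of (2.46) p. 263** (*«R₁ Σ_{n=1}^{k} ∣Γ_n∣ Σ_{j=1}^{n} g_j^{κ₀} < R₁ Σ_{n=1}^{k} ∣Γ_n∣ g_n^{κ₀−6} < Σ_{n=1}^{k}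
∣Γ_n∣, (2.46) for κ₀ ≧ 7 and g sufficiently small»*; `B14FlowStep.SumIneq246`, under its printed binder `7 ≤ κ₀`, in a coupling window);
`thm1` = **Theorem 1 p. 262** for every run of the family (*«There exist constants, introduced in the above description, such that if the
sequence of coupling constants {g_k}, determined by the recursive renormalization group (Callan-Symanzik) equations (0.18), (0.20) [I],
satisfies the inequalities (I.0.33), then the sequence of densities {ρ_k}, generated by successive applications of the operations 𝐑T to
the density ρ₀ = exp[−(1∕g₀²)A − E], satisfies all the inductive assumptions. The constants satisfy numerous restrictions introduced in
the proof.»*; `B14.Thm1Printed H033 (fam i)`, "(I.0.33)" as the parameter `H033`);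
`thm2` = **Theorem 2 p. 263, (2.43)–(2.44)** (*«Under the assumptions of Theorem 1 there exists a constant E₁ independent of j, k, Ω,
{Ω_j}, {Λ_j}, T (but dependent on the other constants occurring in the formulation of this theorem), such that (2.43) for β < 1 …
Similarly, there exists an absolute constant R₁ such, that (2.44)»*; `B14.Thm2Printed H033 fam L β κ₀`, E₁ and R₁ before the run index);
`cor3` = **Corollary 3 (Ultraviolet Stability) p. 264, (2.50)** (*«Under the assumptions of Theorem 1 there exist constants E₋, E₊
independent of η and T, but depending on g_k, such that χ_k(T_η) exp[−g_k⁻²A(U_k(V_k)) − E₋∣T_η∣] ≦ ρ_k(V_k) ≦ e^{E₊∣T_η∣} . (2.50)»*;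
`B16.Cor3_250 C`, whose «under the assumptions of Theorem 1» is its own coupling window).
The other displays of the block ((2.1)–(2.5), (2.7)–(2.42), (2.45), (2.47)–(2.49)) are DEFINITIONS ∕ ASSUMED PROPERTIES of the inductive
description or consequences PROVED in the sibling modules of the module docstring's table, and take no slot.  Explicit carriers: the
construction `C : B16.Construction`, the hypothesis parameter `H033 : Flow → ℕ → Prop` of `B14.Thm1Printed`, the family of §2 data
`fam : I → B14.Sect2Data`, Theorem 2's `L, β, κ₀`, (2.6)'s `β′, β₀`.  Hypothesis slot only; nothing asserted.
[cite: Balaban1988Convergent, (2.6) p.255, Thm 1 p.262, Thm 2 (2.43)-(2.44) p.263, (2.46) p.263, Cor 3 (2.50) p.264] -/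
structure Hyp (C : B16.Construction) (H033 : Flow → ℕ → Prop) {I : Type} (fam : I → B14.Sect2Data)
    (L β β' β₀ : ℝ) (κ₀ : ℕ) : Prop where
  /-- (2.6) p. 255 along every run in a coupling window — in tree: `B14.FlowIneq26`. -/
  flow26 : ∃ γ : ℝ, 0 < γ ∧ ∀ P : B12.RunParams, (C P).flow.InInterval γ P.K →
    B14.FlowIneq26 (C P).flow.g β' β₀ P.K
  /-- (2.46) p. 263, the coupling-sum clause «for κ₀ ≧ 7 and g sufficiently small» — in tree: `B14FlowStep.SumIneq246`. -/
  sum246 : 7 ≤ κ₀ → ∃ γ : ℝ, 0 < γ ∧ ∀ P : B12.RunParams, (C P).flow.InInterval γ P.K →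
    B14FlowStep.SumIneq246 (C P).flow.g κ₀ P.K
  /-- Theorem 1 p. 262, for every run of the family — in tree: `B14.Thm1Printed`. -/
  thm1 : ∀ i : I, B14.Thm1Printed H033 (fam i)
  /-- Theorem 2 p. 263, (2.43)–(2.44), uniformly over the family — in tree: `B14.Thm2Printed`. -/
  thm2 : B14.Thm2Printed H033 fam L β κ₀
  /-- Corollary 3 (2.50) p. 264 — in tree: `B16.Cor3_250`. -/
  cor3 : B16.Cor3_250 C

/-! ## §3 Bookkeeping (kernel-checked uses of the cited declarations; no statement asserted) -/

section Proj

variable {C : B16.Construction} {H033 : Flow → ℕ → Prop} {I : Type} {fam : I → B14.Sect2Data}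
  {L β β' β₀ : ℝ} {κ₀ : ℕ}

/-- **Theorem 1's conclusion at one run and one step** — *«satisfies all the inductive assumptions»* —, under its two hypotheses, by
unfolding `B14.Thm1Printed`. [cite: Balaban1988Convergent, Thm 1 p.262 (bookkeeping)] -/
theorem Hyp.inductiveAssumption (h : Hyp C H033 fam L β β' β₀ κ₀) (i : I)
    (hrg : (fam i).flow.SatisfiesRG (fam i).K) (h033 : H033 (fam i).flow (fam i).K) {k : ℕ} (hk : k ≤ (fam i).K) :
    (fam i).InductiveAssumption k :=
  h.thm1 i hrg h033 k hk

/-- **(2.43) ∧ (2.44) with the uniform constants E₁, R₁** out of the field `thm2` (`B14Thm2.thm2Printed_iff`), for `β < 1`.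
[cite: Balaban1988Convergent, Thm 2 (2.43)-(2.44) p.263 (bookkeeping)] -/
theorem Hyp.ineq243_244 (h : Hyp C H033 fam L β β' β₀ κ₀) (hβ : β < 1) :
    ∃ E₁ R₁ : ℝ, ∀ i : I, (fam i).flow.SatisfiesRG (fam i).K → H033 (fam i).flow (fam i).K →
      B14Thm2.Ineq243 (fam i) L β E₁ ∧ B14Thm2.Ineq244 (fam i) R₁ κ₀ :=
  (B14Thm2.thm2Printed_iff H033 fam L β κ₀).mp h.thm2 hβ

/-- Corollary 3 in its corollary-shaped reading `B16.Cor3Leaf C` (Theorem 1 ⇒ (2.50)), trivially from the field `cor3`.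
[cite: Balaban1988Convergent, Cor 3 p.264 (bookkeeping)] -/
theorem Hyp.cor3Leaf (h : Hyp C H033 fam L β β' β₀ κ₀) : B16.Cor3Leaf C :=
  fun _ => h.cor3

/-- **p. 255 «They imply the following inequalities»: (2.7) ALONG THE RUNS**, from the field `flow26` and the tree's theorem
`B14FlowStep.flowIneq27_of_26`, under that module's explicit smallness `SmallnessFor γₛ β′ β₀ L_b p` (block size `L_b`, exponent `p` of
(2.7)); one window `min γ γₛ` serves every run. [cite: Balaban1988Convergent, (2.6)-(2.7) p.255 (bookkeeping)] -/
theorem Hyp.flow27 (h : Hyp C H033 fam L β β' β₀ κ₀) {γs : ℝ} {Lb p : ℕ} (S : B14FlowStep.SmallnessFor γs β' β₀ Lb p) :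
    ∃ γ : ℝ, 0 < γ ∧ ∀ P : B12.RunParams, (C P).flow.InInterval γ P.K →
      B14.FlowIneq27 (C P).flow.g β' β₀ p P.K := by
  obtain ⟨γ, hγ, h26⟩ := h.flow26
  refine ⟨min γ γs, lt_min hγ S.γ_pos, fun P hP => ?_⟩
  have hPγ : (C P).flow.InInterval γ P.K := B14Cor3.inInterval_of_le hP (min_le_left _ _)
  have hPs : Step.InInterval γs P.K (C P).flow.g := fun k hk => ⟨(hP k hk).1, (hP k hk).2.trans (min_le_right _ _)⟩
  exact B14FlowStep.flowIneq27_of_26 S hPs (h26 P hPγ)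

end Proj

/-! ### The dictionary between the two in-tree typings of Theorem 1 (`B14.Thm1Printed` over §2 data ↔ `B16.Thm1Printed` over a construction) -/

section Dict

variable (C : B16.Construction) {I : Type} (fam : I → B14.Sect2Data)

/-- **[III] Theorem 1 over the §2 data of the runs ⇒ «the §2 [III] description holds at every k ≤ K» along the windowed runs of `C`.**
The run dictionary, all DISPLAYED as hypotheses: `ι P` = the family index of run `P`; its datum has `K = P.K` and the run's flow; its
inductive-assumption predicate implies the construction's `Sect2Form`; the couplings of every run in the window satisfy (0.20) [I]
(`Flow.SatisfiesRG` — Theorem 1's «determined by the recursive renormalization group equations»); "(I.0.33)" read as the interval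
hypothesis `B14.H033Interval γ` ([V] p. 355's reading).  One rewrite; no analytic content. [cite: Balaban1988Convergent, Thm 1 p.262; Balaban1989LargeFieldII, Thm 1 p.355 (bookkeeping)] -/
theorem sect2FormAll_of_thm1B14 {γ : ℝ} (ι : B12.RunParams → I)
    (hK : ∀ P : B12.RunParams, (fam (ι P)).K = P.K) (hflow : ∀ P : B12.RunParams, (fam (ι P)).flow = (C P).flow)
    (hIA : ∀ (P : B12.RunParams) (k : ℕ), k ≤ P.K → (fam (ι P)).InductiveAssumption k → (C P).Sect2Form k)
    (hrg : ∀ P : B12.RunParams, (C P).flow.InInterval γ P.K → (C P).flow.SatisfiesRG P.K)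
    (h1 : ∀ i : I, B14.Thm1Printed (B14.H033Interval γ) (fam i)) :
    ∀ P : B12.RunParams, (C P).flow.InInterval γ P.K → ∀ k, k ≤ P.K → (C P).Sect2Form k := by
  intro P hP k hk
  refine hIA P k hk ?_
  have h := h1 (ι P)
  unfold B14.Thm1Printed B14.H033Interval at h
  rw [hK P, hflow P] at h
  exact h (hrg P hP) hP k hk

/-- **[III] Theorem 1 (family form over §2 data) ⇒ `B16.Thm1Printed C`** along the run dictionary (window `γ > 0`).
[cite: Balaban1988Convergent, Thm 1 p.262; Balaban1989LargeFieldII, Thm 1 p.355 (bookkeeping)] -/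
theorem thm1B16_of_thm1B14 {γ : ℝ} (hγ : 0 < γ) (ι : B12.RunParams → I)
    (hK : ∀ P : B12.RunParams, (fam (ι P)).K = P.K) (hflow : ∀ P : B12.RunParams, (fam (ι P)).flow = (C P).flow)
    (hIA : ∀ (P : B12.RunParams) (k : ℕ), k ≤ P.K → (fam (ι P)).InductiveAssumption k → (C P).Sect2Form k)
    (hrg : ∀ P : B12.RunParams, (C P).flow.InInterval γ P.K → (C P).flow.SatisfiesRG P.K)
    (h1 : ∀ i : I, B14.Thm1Printed (B14.H033Interval γ) (fam i)) : B16.Thm1Printed C :=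
  ⟨γ, hγ, sect2FormAll_of_thm1B14 C fam ι hK hflow hIA hrg h1⟩

variable {C fam} {L β β' β₀ : ℝ} {κ₀ : ℕ}

/-- **`B16.Thm1Printed C` out of the bundle** (field `thm1` at `H033 := B14.H033Interval γ`) along the run dictionary.
[cite: Balaban1988Convergent, Thm 1 p.262 (bookkeeping)] -/
theorem Hyp.thm1B16_of_dict {γ : ℝ} (h : Hyp C (B14.H033Interval γ) fam L β β' β₀ κ₀) (hγ : 0 < γ)
    (ι : B12.RunParams → I)
    (hK : ∀ P : B12.RunParams, (fam (ι P)).K = P.K) (hflow : ∀ P : B12.RunParams, (fam (ι P)).flow = (C P).flow)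
    (hIA : ∀ (P : B12.RunParams) (k : ℕ), k ≤ P.K → (fam (ι P)).InductiveAssumption k → (C P).Sect2Form k)
    (hrg : ∀ P : B12.RunParams, (C P).flow.InInterval γ P.K → (C P).flow.SatisfiesRG P.K) : B16.Thm1Printed C :=
  thm1B16_of_thm1B14 C fam hγ ι hK hflow hIA hrg h.thm1

/-- **Theorem 1's printed proof shape at the window** — the BASE (ρ₀ at k = 0) and the STEP k → k+1 of the induction (`B16.InductionBase C γ
∧ B16.InductionStep C γ`, what block 40's bundle `B16Carve40BoundsCor3Hyp.Hyp.thm1_of_base` consumes) — out of the bundle along the run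
dictionary, by `B16.inductionStep_of_thm1With` (Theorem 1 trivially contains its own base and step).
[cite: Balaban1988Convergent, Thm 1 p.262; Balaban1989LargeFieldII, p.390-391 (bookkeeping)] -/
theorem Hyp.base_step_of_dict {γ : ℝ} (h : Hyp C (B14.H033Interval γ) fam L β β' β₀ κ₀)
    (ι : B12.RunParams → I)
    (hK : ∀ P : B12.RunParams, (fam (ι P)).K = P.K) (hflow : ∀ P : B12.RunParams, (fam (ι P)).flow = (C P).flow)
    (hIA : ∀ (P : B12.RunParams) (k : ℕ), k ≤ P.K → (fam (ι P)).InductiveAssumption k → (C P).Sect2Form k)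
    (hrg : ∀ P : B12.RunParams, (C P).flow.InInterval γ P.K → (C P).flow.SatisfiesRG P.K) :
    B16.InductionBase C γ ∧ B16.InductionStep C γ :=
  B16.inductionStep_of_thm1With C γ (sect2FormAll_of_thm1B14 C fam ι hK hflow hIA hrg h.thm1)

/-- ★ **The KEY item's B16 conjunct out of the bundle**: [III] Theorem 1 (field `thm1`, along the run dictionary) ∧ [III] Corollary 3
(field `cor3`) = `B16.EndStatementBPrinted C` — p. 391 [V] *«This completes the proof of Theorem 1 and Corollary 3»* names exactly this
pair; here it is a HYPOTHESIS unpacked, not a discharge. [cite: Balaban1988Convergent, Thm 1 p.262, Cor 3 p.264; Balaban1989LargeFieldII, p.391 (bookkeeping)] -/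
theorem Hyp.endStatementBPrinted_of_dict {γ : ℝ} (h : Hyp C (B14.H033Interval γ) fam L β β' β₀ κ₀) (hγ : 0 < γ)
    (ι : B12.RunParams → I)
    (hK : ∀ P : B12.RunParams, (fam (ι P)).K = P.K) (hflow : ∀ P : B12.RunParams, (fam (ι P)).flow = (C P).flow)
    (hIA : ∀ (P : B12.RunParams) (k : ℕ), k ≤ P.K → (fam (ι P)).InductiveAssumption k → (C P).Sect2Form k)
    (hrg : ∀ P : B12.RunParams, (C P).flow.InInterval γ P.K → (C P).flow.SatisfiesRG P.K) :
    B16.EndStatementBPrinted C :=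
  B16.endStatementBPrinted_of_leaves C (h.thm1B16_of_dict hγ ι hK hflow hIA hrg) h.cor3Leaf

end Dict

end Literature.MathematicalPhysics.QuantumFieldTheory.Balaban1983to89.B14Carve34Sect2ThmsHyp
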